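import Summits.CriticalPhenomena.PercolationContinuityZ3.Theorems.PercNearOneGluingNoHeavyLowerTailKnQuestion8CoefficientwiseOffCluster
import HarnessLib

/-!
# The OFF-CLUSTER theorem with a boosted blue side (antitone majorants, blue sure-edges) — prim-lf-2 gen 47

Support file (`--supports stmt-CriticalPhenomena-4575`, closed), prover `prim-lf-2` (gen 47).  No definitions, no named facts, no sorries; standard axioms.
Memo `prim-lf-2/CW-QMIX-gen47.md` §2, §6(3); the un-boosted theorem is gen 23's `Coefficientwise.offCluster_twoColouring_nonneg` (…CoefficientwiseOffCluster.lean), whose proof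
is repeated here with one extra inequality.

Setting.  Finite multigraph `ends : ι → Sym2 V`, root `x`, colourings `t : Finset ι` (red) / `tᶜ` (blue), `K(t) = C_x(t) = openCluster (ends '' t) x`.  Gen 23 proved
`Σ_{t : A ∩ K(t) = ∅} (f(K t) − f(K tᶜ))(g(K t) − g(K tᶜ)) ≥ 0` (cells of the red cluster of `A`; on a cell the red cluster of `x` is plain and the blue one contains its mirror).
The same argument tolerates ANY further enlargement of the blue side: if `Φf, Φg : Finset ι → ℝ` are ANTITONE in the red colouring and dominate the blue values,
`f(K tᶜ) ≤ Φf t`, `g(K tᶜ) ≤ Φg t`, then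

* `Coefficientwise.offCluster_majorant_nonneg` — `0 ≤ Σ_{t : A ∩ K(t) = ∅} (f(K t) − Φf t)(g(K t) − Φg t)`.

Instances: `Φf t = f'(K tᶜ)` with `f ≤ f'` monotone (`Coefficientwise.offCluster_boosted_nonneg` — prim-lf-2 gen 25's 'two-function cell lemma', the engine of THEOREM SP's
series step, here for an avoided SET `A`); `Φf t = f(C_x(ends '' tᶜ ∪ X))` for a fixed set `X` of blue SURE-EDGES (`Coefficientwise.offCluster_sureEdges_nonneg` — the blue-gadget
sums `A_S` of the sliced form of NO-CORE, CW-BOX-gen46 §2(e), and the `q`-pendant-at-`x` case of CONJECTURE Q_mix, CW-QMIX-gen47 §2, are of this shape).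
Tool: `Coefficientwise.cell_majorant_nonneg` (FKG on a cell for `t ↦ F t − Φ t`, `F` monotone with the mirror domination, `Φ` an antitone majorant of `t ↦ F tᶜ`).
[cite: KozmaNitzan2024, Questions 8–9 (§5.5 p. 36) (context: the Question-8 pocket covariance programme)]
-/

namespace Summit.CriticalPhenomena.PercolationContinuityZ3.Theorems

open Finset Literature.Probability.Percolation

namespace Coefficientwise

variable {ι V : Type*} [Fintype ι] [DecidableEq ι]

/-- **FKG on a cell with an antitone majorant on the complementary side.**  Let `π ⊆ B`, cell `= {t | t ∩ B = π}`, `F, G : Finset ι → ℝ` monotone with the mirror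
domination `F t ≤ F ((B \ π) ∪ (t \ B))`, `G t ≤ G ((B \ π) ∪ (t \ B))` on the cell, and `ΦF, ΦG` antitone with `F tᶜ ≤ ΦF t`, `G tᶜ ≤ ΦG t` for all `t`.  Then
`0 ≤ Σ_{cell} (F t − ΦF t)(G t − ΦG t)`.  (`t ↦ F t − ΦF t` is monotone with cell sum `≤ Σ_{cell} F tᶜ − Σ_{cell} ΦF t ≤ 0` after the free-coordinate flip; `fkg_cell`.)
[cite: KozmaNitzan2024, Questions 8–9 (§5.5 p. 36) (context)] -/
theorem cell_majorant_nonneg (B π : Finset ι) (hπ : π ⊆ B) (F G ΦF ΦG : Finset ι → ℝ) (hF : Monotone F) (hG : Monotone G)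
    (hΦF : Antitone ΦF) (hΦG : Antitone ΦG)
    (hFle : ∀ t : Finset ι, t ∩ B = π → F t ≤ F ((B \ π) ∪ (t \ B)))
    (hGle : ∀ t : Finset ι, t ∩ B = π → G t ≤ G ((B \ π) ∪ (t \ B)))
    (hdomF : ∀ t : Finset ι, F tᶜ ≤ ΦF t) (hdomG : ∀ t : Finset ι, G tᶜ ≤ ΦG t) :
    0 ≤ ∑ t ∈ univ.filter (fun t : Finset ι => t ∩ B = π), (F t - ΦF t) * (G t - ΦG t) := by
  set cell := univ.filter (fun t : Finset ι => t ∩ B = π) with hcell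
  have mem_cell : ∀ t : Finset ι, t ∈ cell ↔ t ∩ B = π := fun t => by simp [hcell]
  -- the flip of the free coordinates (as in `twoColouring_cell_nonneg_of_le`)
  set τ : Finset ι → Finset ι := fun t => π ∪ (tᶜ \ B) with hτ
  have facts : ∀ t : Finset ι, t ∩ B = π → ∀ i, (i ∈ π ↔ i ∈ t ∧ i ∈ B) := fun t ht i => by
    rw [← ht]; exact Finset.mem_inter
  have memτ : ∀ t i, i ∈ τ t ↔ i ∈ π ∨ (i ∉ t ∧ i ∉ B) := fun t i => by
    simp only [hτ, Finset.mem_union, Finset.mem_sdiff, Finset.mem_compl]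
  have hτcell : ∀ t, t ∩ B = π → τ t ∩ B = π := by
    intro t ht
    ext i
    simp only [Finset.mem_inter, memτ]
    have h1 := facts t ht i
    have h2 : i ∈ π → i ∈ B := fun h => hπ h
    tauto
  have hττ : ∀ t, t ∩ B = π → τ (τ t) = t := by
    intro t ht
    ext i
    rw [memτ, memτ]
    have h1 := facts t ht i
    have h2 : i ∈ π → i ∈ B := fun h => hπ h
    tauto
  have hflip : ∀ t, t ∩ B = π → tᶜ = (B \ π) ∪ (τ t \ B) := by
    intro t ht
    ext i
    simp only [Finset.mem_compl, Finset.mem_union, Finset.mem_sdiff, memτ]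
    have h1 := facts t ht i
    have h2 : i ∈ π → i ∈ B := fun h => hπ h
    tauto
  have reindex : ∀ H : Finset ι → ℝ, ∑ t ∈ cell, H tᶜ = ∑ t ∈ cell, H ((B \ π) ∪ (t \ B)) := by
    intro H
    refine Finset.sum_bij' (fun t _ => τ t) (fun t _ => τ t) ?_ ?_ ?_ ?_ ?_
    · intro t ht; exact (mem_cell _).mpr (hτcell t ((mem_cell t).mp ht))
    · intro t ht; exact (mem_cell _).mpr (hτcell t ((mem_cell t).mp ht))
    · intro t ht; exact hττ t ((mem_cell t).mp ht)
    · intro t ht; exact hττ t ((mem_cell t).mp ht)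
    · intro t ht; rw [hflip t ((mem_cell t).mp ht)]
  -- cell sums: Σ F t ≤ Σ F tᶜ ≤ Σ ΦF t
  have hFc : ∑ t ∈ cell, F t ≤ ∑ t ∈ cell, ΦF t := by
    have h1 : ∑ t ∈ cell, F t ≤ ∑ t ∈ cell, F tᶜ := by
      rw [reindex F]
      exact Finset.sum_le_sum fun t ht => hFle t ((mem_cell t).mp ht)
    exact h1.trans (Finset.sum_le_sum fun t _ => hdomF t)
  have hGc : ∑ t ∈ cell, G t ≤ ∑ t ∈ cell, ΦG t := by
    have h1 : ∑ t ∈ cell, G t ≤ ∑ t ∈ cell, G tᶜ := by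
      rw [reindex G]
      exact Finset.sum_le_sum fun t ht => hGle t ((mem_cell t).mp ht)
    exact h1.trans (Finset.sum_le_sum fun t _ => hdomG t)
  -- FKG on the cell for the monotone functions `F − ΦF`, `G − ΦG` with non-positive cell sums
  set Φ : Finset ι → ℝ := fun t => F t - ΦF t with hΦ
  set Ψ : Finset ι → ℝ := fun t => G t - ΦG t with hΨ
  have hΦm : Monotone Φ := fun s t hst => by
    simp only [hΦ]; linarith [hF hst, hΦF hst]
  have hΨm : Monotone Ψ := fun s t hst => by
    simp only [hΨ]; linarith [hG hst, hΦG hst]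
  have key := fkg_cell B π Φ Ψ hΦm hΨm
  have hΦs : ∑ t ∈ cell, Φ t ≤ 0 := by
    simp only [hΦ, Finset.sum_sub_distrib, sub_nonpos]; exact hFc
  have hΨs : ∑ t ∈ cell, Ψ t ≤ 0 := by
    simp only [hΨ, Finset.sum_sub_distrib, sub_nonpos]; exact hGc
  have hprod : 0 ≤ (∑ t ∈ cell, Φ t) * (∑ t ∈ cell, Ψ t) := mul_nonneg_of_nonpos_of_nonpos hΦs hΨs
  rcases cell.eq_empty_or_nonempty with hce | hne
  · simp [hce]
  · have hcard : (0 : ℝ) < (cell.card : ℝ) := by exact_mod_cast hne.card_pos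
    have : 0 ≤ (cell.card : ℝ) * ∑ t ∈ cell, Φ t * Ψ t := le_trans hprod key
    have h2 : 0 ≤ ∑ t ∈ cell, Φ t * Ψ t := by
      by_contra hlt
      have hlt' : ∑ t ∈ cell, Φ t * Ψ t < 0 := lt_of_not_ge hlt
      have : (cell.card : ℝ) * ∑ t ∈ cell, Φ t * Ψ t < 0 := mul_neg_of_pos_of_neg hcard hlt'
      linarith
    simpa [hΦ, hΨ] using h2

open Classical in
/-- **OFF-CLUSTER with antitone majorants on the blue side.**  For a finite multigraph `ends : ι → Sym2 V`, root `x`, avoided set `A`, monotone `f, g : Set V → ℝ`,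
and `Φf, Φg : Finset ι → ℝ` antitone (in the red colouring) with `f(C_x(tᶜ)) ≤ Φf t`, `g(C_x(tᶜ)) ≤ Φg t` for every `t`:
  `0 ≤ Σ_{t : A ∩ C_x(t) = ∅} (f(C_x t) − Φf t)·(g(C_x t) − Φg t)`.
`Φf t = f(C_x tᶜ)` is gen 23's theorem.  Proof: gen 23's cells of the red cluster of `A` (locality, fibres, off-cluster domination — verbatim) + `cell_majorant_nonneg`.
[cite: KozmaNitzan2024, Questions 8–9 (§5.5 p. 36) (context)] -/
theorem offCluster_majorant_nonneg (ends : ι → Sym2 V) (x : V) (A : Set V) (f g : Set V → ℝ) (hf : Monotone f) (hg : Monotone g)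
    (Φf Φg : Finset ι → ℝ) (hΦf : Antitone Φf) (hΦg : Antitone Φg)
    (hdomf : ∀ t : Finset ι, f (openCluster (ends '' (↑(tᶜ) : Set ι)) x) ≤ Φf t)
    (hdomg : ∀ t : Finset ι, g (openCluster (ends '' (↑(tᶜ) : Set ι)) x) ≤ Φg t) :
    0 ≤ ∑ s ∈ univ.filter (fun s : Finset ι => ∀ a ∈ A, a ∉ openCluster (ends '' (↑s : Set ι)) x),
      (f (openCluster (ends '' (↑s : Set ι)) x) - Φf s) * (g (openCluster (ends '' (↑s : Set ι)) x) - Φg s) := by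
  -- notation
  set K : Finset ι → Set V := fun s => openCluster (ends '' (↑s : Set ι)) x with hK
  set F : Finset ι → ℝ := fun s => f (K s) with hF
  set G : Finset ι → ℝ := fun s => g (K s) with hG
  set D : Finset (Finset ι) := univ.filter (fun s : Finset ι => ∀ a ∈ A, a ∉ openCluster (ends '' (↑s : Set ι)) x) with hD
  change 0 ≤ ∑ s ∈ D, (F s - Φf s) * (G s - Φg s)
  have hKmono : ∀ {s t : Finset ι}, s ⊆ t → K s ⊆ K t := fun hst => openCluster_image_mono ends hst x
  have hFm : Monotone F := fun s t hst => hf (hKmono hst)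
  have hGm : Monotone G := fun s t hst => hg (hKmono hst)
  have hdomF : ∀ t : Finset ι, F tᶜ ≤ Φf t := fun t => hdomf t
  have hdomG : ∀ t : Finset ι, G tᶜ ≤ Φg t := fun t => hdomg t
  -- the red cluster of the set `A`, the edges at a vertex set, and the cell key
  set R : Finset ι → Set V := fun s => {y | ∃ a ∈ A, y ∈ openCluster (ends '' (↑s : Set ι)) a} with hR
  set I : Set V → Finset ι := fun S => univ.filter (fun i : ι => ∃ v ∈ S, v ∈ ends i) with hI
  set key : Finset ι → Set V × Finset ι := fun s => (R s, s ∩ I (R s)) with hkey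
  have R_closed : ∀ (s : Finset ι) {u w : V}, u ∈ R s → (openGraph (ends '' (↑s : Set ι))).Adj u w → w ∈ R s := by
    intro s u w hu hadj
    obtain ⟨a, haA, hau⟩ := hu
    exact ⟨a, haA, SimpleGraph.Reachable.trans hau hadj.reachable⟩
  have mem_I : ∀ (S : Set V) (i : ι) (v : V), v ∈ S → v ∈ ends i → i ∈ I S := by
    intro S i v hv hvi
    simp only [hI, Finset.mem_filter, Finset.mem_univ, true_and]
    exact ⟨v, hv, hvi⟩
  have A_sub_R : ∀ (s : Finset ι), ∀ a ∈ A, a ∈ R s := fun s a ha => ⟨a, ha, mem_openCluster_self _ a⟩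
  -- locality: a configuration agreeing with `s₀` on the edges at `R s₀` has the same red cluster of `A`
  have locality : ∀ s₀ t : Finset ι, t ∩ I (R s₀) = s₀ ∩ I (R s₀) → R t = R s₀ := by
    intro s₀ t ht
    have agree : ∀ i, i ∈ I (R s₀) → (i ∈ t ↔ i ∈ s₀) := by
      intro i hi
      have := congrArg (fun u : Finset ι => i ∈ u) ht
      simp only [Finset.mem_inter, hi, and_true, eq_iff_iff] at this
      exact this
    have h1 : ∀ u ∈ R s₀, ∀ w, (openGraph (ends '' (↑s₀ : Set ι))).Adj u w →
        (openGraph (ends '' (↑t : Set ι))).Adj u w ∧ w ∈ R s₀ := by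
      intro u hu w hadj
      refine ⟨?_, R_closed s₀ hu hadj⟩
      rw [openGraph_image_adj] at hadj ⊢
      obtain ⟨⟨i, his, hi⟩, hne⟩ := hadj
      have hiI : i ∈ I (R s₀) := mem_I _ i u hu (by rw [hi]; exact Sym2.mem_mk_left u w)
      exact ⟨⟨i, (agree i hiI).mpr his, hi⟩, hne⟩
    have h2 : ∀ u ∈ R s₀, ∀ w, (openGraph (ends '' (↑t : Set ι))).Adj u w →
        (openGraph (ends '' (↑s₀ : Set ι))).Adj u w ∧ w ∈ R s₀ := by
      intro u hu w hadj
      have hadj' : (openGraph (ends '' (↑s₀ : Set ι))).Adj u w := by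
        rw [openGraph_image_adj] at hadj ⊢
        obtain ⟨⟨i, hit, hi⟩, hne⟩ := hadj
        have hiI : i ∈ I (R s₀) := mem_I _ i u hu (by rw [hi]; exact Sym2.mem_mk_left u w)
        exact ⟨⟨i, (agree i hiI).mp hit, hi⟩, hne⟩
      exact ⟨hadj', R_closed s₀ hu hadj'⟩
    ext y
    constructor
    · rintro ⟨a, haA, hay⟩
      obtain ⟨p⟩ := hay
      exact ((reachable_transfer (R s₀) h2 p) (A_sub_R s₀ a haA)).2
    · rintro ⟨a, haA, hay⟩
      obtain ⟨p⟩ := hay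
      exact ⟨a, haA, ((reachable_transfer (R s₀) h1 p) (A_sub_R s₀ a haA)).1⟩
  -- split the sum over `D` along the fibres of `key`
  rw [← Finset.sum_fiberwise_of_maps_to (s := D) (t := D.image key) (g := key)
    (fun s hs => Finset.mem_image_of_mem key hs)]
  refine Finset.sum_nonneg fun k hk => ?_
  obtain ⟨s₀, hs₀D, rfl⟩ := Finset.mem_image.mp hk
  have hs₀ : ∀ a ∈ A, a ∉ K s₀ := by
    have := (Finset.mem_filter.mp hs₀D).2
    simpa [hK] using this
  set S₀ : Set V := R s₀ with hS₀
  set B : Finset ι := I S₀ with hB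
  set π : Finset ι := s₀ ∩ B with hπ
  have hxS₀ : x ∉ S₀ := by
    rintro ⟨a, haA, hax⟩
    exact hs₀ a haA (SimpleGraph.Reachable.symm hax)
  have fiber_eq : D.filter (fun t => key t = key s₀) = univ.filter (fun t : Finset ι => t ∩ B = π) := by
    ext t
    simp only [Finset.mem_filter, Finset.mem_univ, true_and]
    constructor
    · rintro ⟨_, hkt⟩
      have h1 : R t = S₀ := (Prod.ext_iff.mp hkt).1
      have h2 : t ∩ I (R t) = s₀ ∩ I (R s₀) := (Prod.ext_iff.mp hkt).2
      rw [h1] at h2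
      exact h2
    · intro ht
      have hRt : R t = S₀ := locality s₀ t ht
      refine ⟨?_, ?_⟩
      · rw [hD, Finset.mem_filter]
        refine ⟨Finset.mem_univ _, fun a haA hax => ?_⟩
        have hxRt : x ∈ R t := ⟨a, haA, SimpleGraph.Reachable.symm hax⟩
        rw [hRt] at hxRt
        exact hxS₀ hxRt
      · change (R t, t ∩ I (R t)) = (R s₀, s₀ ∩ I (R s₀))
        rw [hRt]
        exact Prod.ext rfl ht
  rw [fiber_eq]
  -- on the cell, the red cluster of `x` uses no edge at `S₀`
  have offcluster : ∀ t : Finset ι, t ∩ B = π → K t ⊆ K ((B \ π) ∪ (t \ B)) := by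
    intro t ht
    have agree : ∀ i, i ∈ B → (i ∈ t ↔ i ∈ s₀) := by
      intro i hi
      have := congrArg (fun u : Finset ι => i ∈ u) ht
      simp only [hπ, Finset.mem_inter, hi, and_true, eq_iff_iff] at this
      exact this
    have htr : ∀ u ∈ S₀ᶜ, ∀ w, (openGraph (ends '' (↑t : Set ι))).Adj u w →
        (openGraph (ends '' (↑(t \ B) : Set ι))).Adj u w ∧ w ∈ S₀ᶜ := by
      intro u hu w hadj
      rw [openGraph_image_adj] at hadj
      obtain ⟨⟨i, hit, hi⟩, hne⟩ := hadj
      have hiB : i ∉ B := by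
        intro hiB
        have his₀ : i ∈ s₀ := (agree i hiB).mp hit
        have hiB' := hiB
        simp only [hB, hI, Finset.mem_filter, Finset.mem_univ, true_and] at hiB'
        obtain ⟨v, hvS, hvi⟩ := hiB'
        rw [hi, Sym2.mem_iff] at hvi
        rcases hvi with rfl | rfl
        · exact hu hvS
        · have hadj₀ : (openGraph (ends '' (↑s₀ : Set ι))).Adj v u := by
            rw [openGraph_image_adj]
            exact ⟨⟨i, his₀, by rw [hi, Sym2.eq_swap]⟩, hne.symm⟩
          exact hu (R_closed s₀ hvS hadj₀)
      have hwS : w ∈ S₀ᶜ := by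
        intro hwS
        exact hiB (mem_I S₀ i w hwS (by rw [hi]; exact Sym2.mem_mk_right u w))
      refine ⟨?_, hwS⟩
      rw [openGraph_image_adj]
      exact ⟨⟨i, Finset.mem_sdiff.mpr ⟨hit, hiB⟩, hi⟩, hne⟩
    intro y hy
    obtain ⟨p⟩ := hy
    have hreach := ((reachable_transfer S₀ᶜ htr p) hxS₀).1
    exact hKmono Finset.subset_union_right hreach
  refine cell_majorant_nonneg B π Finset.inter_subset_right F G Φf Φg hFm hGm hΦf hΦg ?_ ?_ hdomF hdomG
  · intro t ht; exact hf (offcluster t ht)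
  · intro t ht; exact hg (offcluster t ht)

open Classical in
/-- **OFF-CLUSTER with boosted blue functions** (gen 25's 'two-function cell lemma' for an avoided set): for monotone `f ≤ f'`, `g ≤ g'`,
`0 ≤ Σ_{t : A ∩ C_x(t) = ∅} (f(C_x t) − f'(C_x tᶜ))(g(C_x t) − g'(C_x tᶜ))`. [cite: KozmaNitzan2024, Questions 8–9 (§5.5 p. 36) (context)] -/
theorem offCluster_boosted_nonneg (ends : ι → Sym2 V) (x : V) (A : Set V) (f f' g g' : Set V → ℝ) (hf : Monotone f) (hg : Monotone g)
    (hf' : Monotone f') (hg' : Monotone g') (hff' : ∀ C, f C ≤ f' C) (hgg' : ∀ C, g C ≤ g' C) :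
    0 ≤ ∑ s ∈ univ.filter (fun s : Finset ι => ∀ a ∈ A, a ∉ openCluster (ends '' (↑s : Set ι)) x),
      (f (openCluster (ends '' (↑s : Set ι)) x) - f' (openCluster (ends '' (↑(sᶜ) : Set ι)) x)) *
        (g (openCluster (ends '' (↑s : Set ι)) x) - g' (openCluster (ends '' (↑(sᶜ) : Set ι)) x)) := by
  refine offCluster_majorant_nonneg ends x A f g hf hg (fun t => f' (openCluster (ends '' (↑(tᶜ) : Set ι)) x))
    (fun t => g' (openCluster (ends '' (↑(tᶜ) : Set ι)) x)) ?_ ?_ (fun t => hff' _) (fun t => hgg' _)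
  · intro s t hst
    exact hf' (openCluster_image_mono ends (compl_subset_compl.mpr hst) x)
  · intro s t hst
    exact hg' (openCluster_image_mono ends (compl_subset_compl.mpr hst) x)

open Classical in
/-- **OFF-CLUSTER with blue sure-edges.**  For a fixed set `X ⊆ Sym2 V` of extra edges that are always available to the BLUE cluster (a blue gadget),
`0 ≤ Σ_{t : A ∩ C_x(t) = ∅} (f(C_x t) − f(C_x(ends '' tᶜ ∪ X)))(g(C_x t) − g(C_x(ends '' tᶜ ∪ X)))` — the blue-gadget Harris sums `A_S` of the sliced form of NO-CORE
(CW-BOX-gen46 §2(e)) are of this shape. [cite: KozmaNitzan2024, Questions 8–9 (§5.5 p. 36) (context)] -/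
theorem offCluster_sureEdges_nonneg (ends : ι → Sym2 V) (x : V) (A : Set V) (X : Set (Sym2 V)) (f g : Set V → ℝ) (hf : Monotone f) (hg : Monotone g) :
    0 ≤ ∑ s ∈ univ.filter (fun s : Finset ι => ∀ a ∈ A, a ∉ openCluster (ends '' (↑s : Set ι)) x),
      (f (openCluster (ends '' (↑s : Set ι)) x) - f (openCluster (ends '' (↑(sᶜ) : Set ι) ∪ X) x)) *
        (g (openCluster (ends '' (↑s : Set ι)) x) - g (openCluster (ends '' (↑(sᶜ) : Set ι) ∪ X) x)) := by
  refine offCluster_majorant_nonneg ends x A f g hf hg (fun t => f (openCluster (ends '' (↑(tᶜ) : Set ι) ∪ X) x))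
    (fun t => g (openCluster (ends '' (↑(tᶜ) : Set ι) ∪ X) x)) ?_ ?_ ?_ ?_
  · intro s t hst
    exact hf (openCluster_mono (Set.union_subset_union_left X (Set.image_mono (Finset.coe_subset.mpr (compl_subset_compl.mpr hst)))) x)
  · intro s t hst
    exact hg (openCluster_mono (Set.union_subset_union_left X (Set.image_mono (Finset.coe_subset.mpr (compl_subset_compl.mpr hst)))) x)
  · intro t
    exact hf (openCluster_mono Set.subset_union_left x)
  · intro t
    exact hg (openCluster_mono Set.subset_union_left x)

end Coefficientwise

end Summit.CriticalPhenomena.PercolationContinuityZ3.Theorems
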